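import Summits.Ventures.PercRepro.S2ContractionCaps
import Summits.Ventures.PercRepro.RankLevelSetPlaneSix

/-!
# PercRepro — S2: THE `5`-SUBSETS OF RANK `≤ 3` OF A `9`-POINT SET OF RANK `5` (p7, gen 14; sub-claim S2; the case `ν = 4` of `(14, 7)`)

The last structural count of the contraction lever at `w = 9`: a `5`-subset `T ⊆ W` of rank `≤ 3` has rank `3` and lies in the plane
`cl(T) ∩ W` of `≤ 6` points (the core's `f(3) = 6`, `ThmN.ncard_le_six_of_eRk_le_three_of_free`). If that plane has `6` points it is the same for
every such `T` (two distinct `6`-point planes inside `W` would share `≤ 3` points — their intersection has rank `≤ 2` — so cover the `9` points of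
`W` and give `ρ(W) ≤ 4`): at most `C(6, 5) = 6` such `T`. If it has `5` points it equals `T`, and two such `T`'s share no `4`-subset (a common
rank-`3` `4`-subset has the same closure): the `5` four-subsets of each are disjoint families inside the `C(9, 4) = 126` four-subsets of `W`
(`Finset.card_mul_le_card_mul`), so at most `25` such `T`. **`ncard_five_eRk_le_three_le`**: `R₅³(W) ≤ 31`. Axioms: standard.
-/

open scoped Matroid

namespace PercRepro

namespace S2

open Set

variable {α : Type}

/-- A set of rank `≤ 2` has `≤ 3` points when two distinct points have rank `2` and lines have `≤ 3` points. -/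
theorem ncard_le_three_of_eRk_le_two (M : Matroid α) [M.Finite]
    (hs : ∀ e ∈ M.E, ∀ f ∈ M.E, e ≠ f → M.eRk {e, f} = 2)
    (hC1 : ∀ L ⊆ M.E, M.eRk L = 2 → L.ncard ≤ 3) {X : Set α} (hX : X ⊆ M.E) (hr : M.eRk X ≤ 2) : X.ncard ≤ 3 := by
  have hXfin : X.Finite := M.ground_finite.subset hX
  by_contra hlt
  push Not at hlt
  obtain ⟨x, y, hxy, hx, hy⟩ : ∃ x y, x ≠ y ∧ x ∈ X ∧ y ∈ X := by
    obtain ⟨x, y, hxy, hx, hy⟩ := (Set.one_lt_ncard_iff hXfin).1 (by omega)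
    exact ⟨x, y, hy, hxy, hx⟩
  have h2 : M.eRk {x, y} = 2 := hs x (hX hx) y (hX hy) hxy
  have hle : (2 : ℕ∞) ≤ M.eRk X := h2 ▸ M.eRk_mono (Set.pair_subset hx hy)
  have := hC1 X hX (le_antisymm hr hle)
  omega

open scoped Classical in
/-- **The `5`-subsets of rank `≤ 3` of a `9`-point set of rank `5`: at most `31`.** -/
theorem ncard_five_eRk_le_three_le (M : Matroid α) [M.Finite]
    (hfree : ∀ e ∈ M.E, ∃ A ⊆ M.E \ {e}, e ∉ M.closure A ∧ e ∉ M.closure ((M.E \ {e}) \ A))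
    (hs : ∀ e ∈ M.E, ∀ f ∈ M.E, e ≠ f → M.eRk {e, f} = 2)
    (hC1 : ∀ L ⊆ M.E, M.eRk L = 2 → L.ncard ≤ 3)
    {W : Set α} (hW : W ⊆ M.E) (hW9 : W.ncard = 9) (hWr : M.eRk W = 5) :
    {T : Set α | T ⊆ W ∧ T.ncard = 5 ∧ M.eRk T ≤ 3}.ncard ≤ 31 := by
  have hWfin : W.Finite := M.ground_finite.subset hW
  set R := {T : Set α | T ⊆ W ∧ T.ncard = 5 ∧ M.eRk T ≤ 3} with hR
  have hRfin : R.Finite := hWfin.finite_subsets.subset (fun T hT => hT.1)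
  -- a set of `≥ 4` points inside a rank-`≤ 3` set has rank exactly `3`
  have hrank3 : ∀ {X : Set α}, X ⊆ M.E → 4 ≤ X.ncard → M.eRk X ≤ 3 → M.eRk X = 3 := by
    intro X hX h4 h3
    refine le_antisymm h3 ?_
    by_contra hlt
    push Not at hlt
    have h2 : M.eRk X ≤ 2 := by
      have h : M.eRk X < (2 : ℕ∞) + 1 := by
        rw [show (2 : ℕ∞) + 1 = 3 by norm_num]
        exact hlt
      exact Order.le_of_lt_add_one h
    have := ncard_le_three_of_eRk_le_two M hs hC1 hX h2
    omega
  -- the plane of `T`: `P T := cl T ∩ W`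
  let P : Set α → Set α := fun T => M.closure T ∩ W
  have hPsub : ∀ T ∈ R, T ⊆ P T := fun T hT x hx => ⟨M.subset_closure T (hT.1.trans hW) hx, hT.1 hx⟩
  have hPcard : ∀ T ∈ R, (P T).ncard ≤ 6 := by
    intro T hT
    have hcl : M.closure T ⊆ M.E := M.closure_subset_ground T
    have hr : M.eRk (M.closure T) ≤ 3 := by rw [M.eRk_closure_eq]; exact hT.2.2
    have h6 := ThmN.ncard_le_six_of_eRk_le_three_of_free M hfree hcl hr
    exact (Set.ncard_le_ncard Set.inter_subset_left (M.ground_finite.subset hcl)).trans h6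
  have hP5 : ∀ T ∈ R, 5 ≤ (P T).ncard := fun T hT =>
    hT.2.1 ▸ Set.ncard_le_ncard (hPsub T hT) (hWfin.subset Set.inter_subset_right)
  -- `cl (P T) = cl T`
  have hclP : ∀ T ∈ R, M.closure (P T) = M.closure T := by
    intro T hT
    refine le_antisymm ?_ (M.closure_subset_closure (hPsub T hT))
    calc M.closure (P T) ⊆ M.closure (M.closure T) := M.closure_subset_closure Set.inter_subset_left
      _ = M.closure T := M.closure_closure T
  -- a `4`-subset `Q` of `T ∈ R` has `cl Q = cl T`
  have hclQ : ∀ T ∈ R, ∀ Q ⊆ T, Q.ncard = 4 → M.closure Q = M.closure T := by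
    intro T hT Q hQT hQ4
    have hTE : T ⊆ M.E := hT.1.trans hW
    have hQE : Q ⊆ M.E := hQT.trans hTE
    have hrQ : M.eRk Q = 3 := hrank3 hQE (by omega) ((M.eRk_mono hQT).trans hT.2.2)
    have hrT : M.eRk T = 3 := hrank3 hTE (by have := hT.2.1; omega) hT.2.2
    exact (M.isRkFinite_set Q).closure_eq_closure_of_subset_of_eRk_ge_eRk hQT (by rw [hrQ, hrT])
  -- the two parts
  set R6 := {T ∈ R | (P T).ncard = 6} with hR6
  set R5 := {T ∈ R | (P T).ncard = 5} with hR5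
  have hcover : R ⊆ R6 ∪ R5 := by
    intro T hT
    have h1 := hPcard T hT
    have h2 := hP5 T hT
    rcases (show (P T).ncard = 6 ∨ (P T).ncard = 5 by omega) with h | h
    · exact Or.inl ⟨hT, h⟩
    · exact Or.inr ⟨hT, h⟩
  -- part 1: the `6`-point plane is unique, so `R6 ⊆ 𝒫₅(P T₀)`
  have hR6le : R6.ncard ≤ 6 := by
    by_cases hne : R6.Nonempty
    · obtain ⟨T₀, hT₀⟩ := hne
      have hsub : R6 ⊆ {T : Set α | T ⊆ P T₀ ∧ T.ncard = 5} := by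
        rintro T ⟨hT, hT6⟩
        refine ⟨?_, hT.2.1⟩
        -- `P T = P T₀`
        by_contra hcon
        have hne' : P T ≠ P T₀ := fun h => hcon (h ▸ hPsub T hT)
        have hPE : P T ⊆ M.E := Set.inter_subset_right.trans hW
        have hP₀E : P T₀ ⊆ M.E := Set.inter_subset_right.trans hW
        have hPfin : (P T).Finite := M.ground_finite.subset hPE
        have hP₀fin : (P T₀).Finite := M.ground_finite.subset hP₀E
        have hrP : M.eRk (P T) = 3 := hrank3 hPE (by omega) (by
          calc M.eRk (P T) ≤ M.eRk (M.closure T) := M.eRk_mono Set.inter_subset_left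
            _ = M.eRk T := M.eRk_closure_eq T
            _ ≤ 3 := hT.2.2)
        have hT₀6 : (P T₀).ncard = 6 := hT₀.2
        have hrP₀ : M.eRk (P T₀) = 3 := hrank3 hP₀E (by omega) (by
          calc M.eRk (P T₀) ≤ M.eRk (M.closure T₀) := M.eRk_mono Set.inter_subset_left
            _ = M.eRk T₀ := M.eRk_closure_eq T₀
            _ ≤ 3 := hT₀.1.2.2)
        -- the intersection has rank `≤ 2`: otherwise the two planes coincide
        have hI : M.eRk (P T ∩ P T₀) ≤ 2 := by
          by_contra h3
          push Not at h3
          have hI3 : M.eRk (P T ∩ P T₀) = 3 := le_antisymm ((M.eRk_mono Set.inter_subset_left).trans hrP.le) (Order.add_one_le_of_lt h3)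
          have hc1 : M.closure (P T ∩ P T₀) = M.closure (P T) :=
            (M.isRkFinite_set _).closure_eq_closure_of_subset_of_eRk_ge_eRk Set.inter_subset_left (by rw [hI3, hrP])
          have hc2 : M.closure (P T ∩ P T₀) = M.closure (P T₀) :=
            (M.isRkFinite_set _).closure_eq_closure_of_subset_of_eRk_ge_eRk Set.inter_subset_right (by rw [hI3, hrP₀])
          apply hne'
          show M.closure T ∩ W = M.closure T₀ ∩ W
          rw [← hclP T hT, ← hclP T₀ hT₀.1, ← hc1, hc2]
        have hI3 : (P T ∩ P T₀).ncard ≤ 3 := ncard_le_three_of_eRk_le_two M hs hC1 (Set.inter_subset_left.trans hPE) hI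
        have hU := Set.ncard_union_add_ncard_inter (P T) (P T₀) hPfin hP₀fin
        rw [hT6, hT₀6] at hU
        have hUW : P T ∪ P T₀ ⊆ W := Set.union_subset Set.inter_subset_right Set.inter_subset_right
        have hUcard : (P T ∪ P T₀).ncard ≤ 9 := hW9 ▸ Set.ncard_le_ncard hUW hWfin
        have hUeq : P T ∪ P T₀ = W := Set.eq_of_subset_of_ncard_le hUW (by omega) hWfin
        have hIc : (P T ∩ P T₀).ncard = 3 := by omega
        -- the intersection has `3` points, hence rank `≥ 2`
        have hI2 : (2 : ℕ∞) ≤ M.eRk (P T ∩ P T₀) := by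
          obtain ⟨x, y, hxy, hx, hy⟩ : ∃ x y, x ≠ y ∧ x ∈ P T ∩ P T₀ ∧ y ∈ P T ∩ P T₀ := by
            obtain ⟨x, y, hxy, hx, hy⟩ := (Set.one_lt_ncard_iff (hPfin.inter_of_left (P T₀))).1 (by omega)
            exact ⟨x, y, hy, hxy, hx⟩
          have h2 : M.eRk {x, y} = 2 := hs x (hPE hx.1) y (hPE hy.1) hxy
          exact h2 ▸ M.eRk_mono (Set.pair_subset hx hy)
        have hsm := M.eRk_inter_add_eRk_union_le (P T) (P T₀)
        rw [hUeq, hWr, hrP, hrP₀] at hsm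
        have : (2 : ℕ∞) + 5 ≤ 3 + 3 := (add_le_add hI2 le_rfl).trans hsm
        norm_num at this
      have hP₀fin : (P T₀).Finite := hWfin.subset Set.inter_subset_right
      calc R6.ncard ≤ {T : Set α | T ⊆ P T₀ ∧ T.ncard = 5}.ncard :=
            Set.ncard_le_ncard hsub (hP₀fin.finite_subsets.subset (fun T hT => hT.1))
        _ = (P T₀).ncard.choose 5 := ncard_subsets_ncard_eq (P T₀) hP₀fin 5
        _ = 6 := by rw [hT₀.2]; decide
    · rw [Set.not_nonempty_iff_eq_empty] at hne
      rw [hne, Set.ncard_empty]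
      omega
  -- part 2: the `5`-point planes are their own `T`, pairwise sharing no `4`-subset
  have hR5le : R5.ncard * 5 ≤ W.ncard.choose 4 := by
    set Wf : Finset α := hWfin.toFinset with hWf
    have hWfc : (Wf : Set α) = W := Set.Finite.coe_toFinset _
    set s : Finset (Set α) := (Matroid.subsF Wf 5).filter (fun T => M.eRk T ≤ 3 ∧ (P T).ncard = 5) with hsdef
    set t : Finset (Set α) := Matroid.subsF Wf 4 with htdef
    have hmem_s : ∀ T, T ∈ s ↔ T ∈ R5 := by
      intro T
      rw [hsdef, Finset.mem_filter, mem_subsF_iff, hWfc]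
      show (T ⊆ W ∧ T.ncard = 5) ∧ M.eRk T ≤ 3 ∧ (P T).ncard = 5 ↔ (T ⊆ W ∧ T.ncard = 5 ∧ M.eRk T ≤ 3) ∧ (P T).ncard = 5
      tauto
    have hcard_s : R5.ncard = s.card := by
      rw [← Set.ncard_coe_finset s]
      congr 1
      ext T
      rw [Finset.mem_coe, hmem_s]
    have hcard_t : t.card ≤ W.ncard.choose 4 := by
      have h := Matroid.card_subsF_le Wf 4
      rw [hWf, ← Set.ncard_eq_toFinset_card W hWfin] at h
      exact h
    rw [hcard_s]
    refine le_trans (Finset.card_mul_le_card_mul (fun (T : Set α) (Q : Set α) => Q ⊆ T) ?_ ?_) (by rw [mul_one]; exact hcard_t)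
    · -- each `T` has five `4`-subsets below it
      intro T hT
      obtain ⟨hTR, -⟩ := (hmem_s T).1 hT
      have hTfin : T.Finite := hWfin.subset hTR.1
      have himg : (hTfin.toFinset.image (fun x => T \ {x})) ⊆ t.bipartiteAbove (fun (T : Set α) (Q : Set α) => Q ⊆ T) T := by
        intro Q hQ
        obtain ⟨x, hx, rfl⟩ := Finset.mem_image.1 hQ
        rw [Set.Finite.mem_toFinset] at hx
        rw [Finset.mem_bipartiteAbove]
        refine ⟨Matroid.mem_subsF_of (by rw [hWfc]; exact sdiff_subset.trans hTR.1) ?_, sdiff_subset⟩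
        rw [Set.ncard_sdiff (Set.singleton_subset_iff.2 hx) (Set.finite_singleton x), Set.ncard_singleton, hTR.2.1]
      have hinj : Set.InjOn (fun x => T \ {x}) (hTfin.toFinset : Set α) := by
        intro x hx y hy hxy
        simp only [Set.Finite.coe_toFinset] at hx hy
        have hxy' : T \ {x} = T \ {y} := hxy
        by_contra hne
        have : x ∈ T \ {y} := ⟨hx, fun h => hne (Set.mem_singleton_iff.1 h)⟩
        rw [← hxy'] at this
        exact this.2 (Set.mem_singleton x)
      calc 5 = hTfin.toFinset.card := by rw [← Set.ncard_eq_toFinset_card T hTfin, hTR.2.1]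
        _ = (hTfin.toFinset.image (fun x => T \ {x})).card := (Finset.card_image_of_injOn hinj).symm
        _ ≤ _ := Finset.card_le_card himg
    · -- a `4`-subset lies in at most one `T`
      intro Q hQ
      obtain ⟨hQW, hQ4⟩ := mem_subsF_iff.1 hQ
      rw [hWfc] at hQW
      rw [Finset.card_le_one]
      intro T₁ hT₁ T₂ hT₂
      rw [Finset.mem_bipartiteBelow] at hT₁ hT₂
      obtain ⟨hT₁s, hQT₁⟩ := hT₁
      obtain ⟨hT₂s, hQT₂⟩ := hT₂
      obtain ⟨hT₁R, hT₁5⟩ := (hmem_s T₁).1 hT₁s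
      obtain ⟨hT₂R, hT₂5⟩ := (hmem_s T₂).1 hT₂s
      -- `P Tᵢ = Tᵢ` and `cl T₁ = cl Q = cl T₂`
      have hP₁ : P T₁ = T₁ := (Set.eq_of_subset_of_ncard_le (hPsub T₁ hT₁R) (by rw [hT₁5, hT₁R.2.1]) (hWfin.subset Set.inter_subset_right)).symm
      have hP₂ : P T₂ = T₂ := (Set.eq_of_subset_of_ncard_le (hPsub T₂ hT₂R) (by rw [hT₂5, hT₂R.2.1]) (hWfin.subset Set.inter_subset_right)).symm
      have hc : M.closure T₁ = M.closure T₂ := by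
        rw [← hclQ T₁ hT₁R Q hQT₁ hQ4, hclQ T₂ hT₂R Q hQT₂ hQ4]
      calc T₁ = P T₁ := hP₁.symm
        _ = M.closure T₁ ∩ W := rfl
        _ = M.closure T₂ ∩ W := by rw [hc]
        _ = T₂ := hP₂
  have hu := Set.ncard_le_ncard hcover ((hRfin.subset (fun T hT => hT.1)).union (hRfin.subset (fun T hT => hT.1)))
  have hu1 := Set.ncard_union_le R6 R5
  rw [hW9] at hR5le
  norm_num [Nat.choose] at hR5le
  omega

end S2

end PercRepro
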